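import Mathlib
import HarnessLib
import Literature.Analysis.FluidPDE.CKNEpsilonRegularityAssemblyProofs
import Literature.Analysis.FluidPDE.CKNLocalEnergyEstimate
import Literature.Analysis.FluidPDE.CKNPressureEstimate
import Literature.Analysis.FluidPDE.CKNInterpolationEstimate
import Literature.Analysis.FluidPDE.SereginEpsilonRegularityProofs
import Literature.Analysis.FluidPDE.LocalTypeIWeakSerrinProofs
import Literature.Analysis.FluidPDE.LocalTypeI

/-!
# Route `AxisTwistDoor`, crux `AveragedConeLiouville` (stmt-NavierStokesRegularity-26889) — toward replacing the
# Lei–Ren input (programme R2), piece S1: CKN's PROPOSITION 2 ON THE BLOW-UP LID (backward form)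

Caffarelli–Kohn–Nirenberg's ε-regularity criterion (Proposition 2; tree: `ckn_epsilon_regularity_holds`) is stated for
INTERIOR points of an open set with CENTRED cylinders.  Programme R2 (LEAD census CENSUS-26889-g2.md) needs it at
the points of the LID `t = T` of a backward cylinder `Q_1(T, x₀)` on which `u` is a suitable weak solution
(`IsSuitableWeakSolutionInBall 1 (T, x₀) u p`, Albritton–Barker's class), in BACKWARD form:

* `lid_epsilon_regularity` — there is an absolute `ε > 0` such that for every such `(u, p)`, every weak spatial
  gradient `G` of `u` on the open cylinder and every `x ∈ B(x₀, 1)`: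
  `limsup_{r→0⁺} r⁻¹ ∫∫_{Q_r(T,x)} |G|² ≤ ε` implies that `(T, x)` is NOT a backward-singular point of `u`
  (`u ∈ L^∞(Q_ρ(T, x))` for some `ρ > 0`).  This is exactly the hypothesis of piece S2
  (`…LidTheoremB.isParabolicNull_lidSingularSet`), whence Theorem B on the lid.

Proof (CKN §6 / Robinson–Rodrigo–Sadowski Thm. 16.1, run as in the tree's `ckn_epsilon_regularity_of_estimates` but
with the auxiliary centre shifted DOWNWARD): with the three proved estimates (`localEnergyEstimate_holds`,
`pressureEstimate_holds`, `interpolationEstimate_holds`) and the abstract scheme `CKN1982.decay_scheme`, the a-priori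
bounds being the GLOBAL classes of the solution on `Q_1(T, x₀)` (not a compact box), one fixes the starting scale `r₀`,
the number of steps `k` and the final scale `ρ = θᵏ r₀` BEFORE the shift; then for every `0 < η ≤ ρ²` the scheme at
the interior centre `z_η = (T − η, x)` (all its cylinders have closure inside the open cylinder, and
`E(s; z_η) ≤ 2 E(2s; (T,x)) < ε` along the scales since `Q_s(z_η) ⊆ Q_{2s}(T, x)`) gives
`C(ρ; z_η) + D(ρ; z_η) ≤ ε₀³`, and the QUANTITATIVE one-scale criterion (`unforced_epsilonRegularity_of_theorem15_3`
with `RRS2016.theorem15_3_holds`, on the Lemarié-Rieusset class furnished by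
`IsSuitableWeakSolutionInBall.exists_isLRSuitableWeakSolutionOn`; it needs only the OPEN inclusion `Q_ρ(z_η) ⊆ Q`)
bounds `|u| ≤ C₀ε₀/ρ` a.e. on `Q_{ρ/2}(z_η)`, uniformly in `η`; the cylinders `Q_{ρ/2}(z_{η_n})`, `η_n → 0`,
exhaust `Q_{ρ/2}(T, x)`.

Seat ns-atd-p1 (LEAD g2).  WHAT THIS IS NOT: not a statement about Navier–Stokes regularity; a linear-parabolic
partial-regularity lemma serving a STAGED door route; the crux stays conditional on Lei–Ren 2024 until R2 completes.
Lands `--supports` the crux item as a helper.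
-/

noncomputable section

set_option linter.dupNamespace false

namespace Summit.NavierStokesRegularity.NavierStokesRegularity.Theorems.AveragedConeLiouville.LidEpsilon

open scoped ENNReal NNReal Topology InnerProductSpace RealInnerProductSpace
open Set Function MeasureTheory Metric Filter TopologicalSpace
open Literature.Analysis.FluidPDE

/-! ### Small helpers -/

/-- The scaled force quantity of the zero force vanishes (`q > 0`). -/
theorem cknF_zero {q r : ℝ} (hq : 0 < q) (z : ℝ × EuclideanSpace ℝ (Fin 3)) :
    cknF q r z (0 : ℝ → EuclideanSpace ℝ (Fin 3) → EuclideanSpace ℝ (Fin 3)) = 0 := by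
  simp only [cknF, Pi.zero_apply, enorm_zero]
  rw [ENNReal.zero_rpow_of_pos hq, lintegral_zero, mul_zero]

/-- A backward cylinder about the downward-shifted centre `(T − η, x)`, `0 ≤ η ≤ 3s²`, lies in the backward cylinder
of doubled radius about `(T, x)`. -/
theorem parabolicCylinder_shift_down_subset {T η s : ℝ} {x : EuclideanSpace ℝ (Fin 3)} (hη : 0 ≤ η)
    (hηs : η ≤ 3 * s ^ 2) (hs : 0 ≤ s) :
    parabolicCylinder s ((T - η, x) : ℝ × EuclideanSpace ℝ (Fin 3)) ⊆ parabolicCylinder (2 * s) (T, x) := by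
  rintro ⟨t, y⟩ h
  rw [mem_parabolicCylinder] at h ⊢
  obtain ⟨⟨h1, h2⟩, h3⟩ := h
  simp only at h1 h2 h3 ⊢
  exact ⟨⟨by nlinarith, by linarith⟩, lt_of_lt_of_le h3 (by linarith)⟩

/-- The dissipation at the shifted centre is at most twice the dissipation at the doubled scale about `(T, x)`:
`E(s; (T−η, x)) ≤ 2 E(2s; (T, x))` for `0 ≤ η ≤ 3s²`, `s > 0`. -/
theorem cknE_shift_down_le {T η s : ℝ} {x : EuclideanSpace ℝ (Fin 3)} (hη : 0 ≤ η) (hηs : η ≤ 3 * s ^ 2)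
    (hs : 0 < s) (G : ℝ → EuclideanSpace ℝ (Fin 3) → EuclideanSpace ℝ (Fin 3) →L[ℝ] EuclideanSpace ℝ (Fin 3)) :
    cknE s ((T - η, x) : ℝ × EuclideanSpace ℝ (Fin 3)) G ≤ 2 * cknE (2 * s) (T, x) G := by
  unfold cknE
  have hsub := parabolicCylinder_shift_down_subset (T := T) (x := x) hη hηs hs.le
  have h2 : (ENNReal.ofReal s)⁻¹ = 2 * (ENNReal.ofReal (2 * s))⁻¹ := by
    rw [ENNReal.ofReal_mul (by norm_num : (0:ℝ) ≤ 2), ENNReal.ofReal_ofNat,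
      ENNReal.mul_inv (Or.inl two_ne_zero) (Or.inl ENNReal.ofNat_ne_top), ← mul_assoc,
      ENNReal.mul_inv_cancel two_ne_zero ENNReal.ofNat_ne_top, one_mul]
  rw [h2, mul_assoc]
  exact mul_le_mul' le_rfl (mul_le_mul' le_rfl (lintegral_mono_set hsub))

/-- The backward cylinder `Q_{ρ/2}(T, x)` is exhausted by the cylinders `Q_{ρ/2}(T − ρ²/(n+2), x)`, `n ∈ ℕ`. -/
theorem parabolicCylinder_subset_iUnion_shift {T ρ : ℝ} {x : EuclideanSpace ℝ (Fin 3)} (hρ : 0 < ρ) :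
    parabolicCylinder (ρ / 2) ((T, x) : ℝ × EuclideanSpace ℝ (Fin 3)) ⊆
      ⋃ n : ℕ, parabolicCylinder (ρ / 2) ((T - ρ ^ 2 / ((n : ℝ) + 2), x) : ℝ × EuclideanSpace ℝ (Fin 3)) := by
  rintro ⟨t, y⟩ h
  rw [mem_parabolicCylinder] at h
  obtain ⟨⟨h1, h2⟩, h3⟩ := h
  simp only at h1 h2 h3
  obtain ⟨n, hn⟩ := exists_nat_gt (ρ ^ 2 / (T - t))
  have hTt : 0 < T - t := by linarith
  refine mem_iUnion.2 ⟨n, ?_⟩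
  rw [mem_parabolicCylinder]
  simp only
  have hn2 : (0 : ℝ) < (n : ℝ) + 2 := by positivity
  have hη : ρ ^ 2 / ((n : ℝ) + 2) < T - t := by
    rw [div_lt_iff₀ hn2]
    have := (div_lt_iff₀ hTt).1 hn
    nlinarith
  have hη0 : 0 < ρ ^ 2 / ((n : ℝ) + 2) := by positivity
  exact ⟨⟨by nlinarith, by linarith⟩, h3⟩

/-! ### Proposition 2 on the lid -/

/-- **Caffarelli–Kohn–Nirenberg's Proposition 2 at the points of the blow-up lid, backward form.**  There is an
absolute `ε > 0` such that: if `(u, p)` is a suitable weak solution of the unit-viscosity unforced Navier–Stokes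
system in the parabolic ball `Q_1(T, x₀)` in Albritton–Barker's class (`IsSuitableWeakSolutionInBall`), `G` is a weak
spatial gradient of `u` there, `x ∈ B(x₀, 1)`, and `limsup_{r→0⁺} r⁻¹∫∫_{Q_r(T,x)} |G|² ≤ ε`, then `(T, x)` is not a
backward-singular point of `u`. [cite: CaffarelliKohnNirenberg1982, Proposition 2 and §6; RobinsonRodrigoSadowski2016,
Thm. 16.1 / Cor. 15.6] -/
theorem lid_epsilon_regularity : ∃ ε : ℝ, 0 < ε ∧
    ∀ (z₀ : ℝ × EuclideanSpace ℝ (Fin 3)) (u : ℝ → EuclideanSpace ℝ (Fin 3) → EuclideanSpace ℝ (Fin 3))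
      (p : ℝ → EuclideanSpace ℝ (Fin 3) → ℝ)
      (G : ℝ → EuclideanSpace ℝ (Fin 3) → EuclideanSpace ℝ (Fin 3) →L[ℝ] EuclideanSpace ℝ (Fin 3)),
      IsSuitableWeakSolutionInBall 1 z₀ u p → HasWeakSpatialGradientOn (parabolicCylinderOpens 1 z₀) u G →
      ∀ x ∈ ball z₀.2 1,
        limsup (fun r : ℝ => cknE r ((z₀.1, x) : ℝ × EuclideanSpace ℝ (Fin 3)) G) (𝓝[>] (0 : ℝ)) ≤
          ENNReal.ofReal ε →
        ¬ IsBackwardSingularPoint u (z₀.1, x) := by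
  obtain ⟨κ₁, κ₂, κ₃, κ₄, hLE⟩ := localEnergyEstimate_holds
  obtain ⟨κ₅, κ₆, hPE⟩ := pressureEstimate_holds
  obtain ⟨C₀, hIE⟩ := interpolationEstimate_holds
  obtain ⟨ε₀q, C₀q, hε₀q, hC₀q, hunf⟩ := unforced_epsilonRegularity_of_theorem15_3 RRS2016.theorem15_3_holds
  -- the abstract scheme with the real constants, targeting `C + D ≤ ε₀q³`
  obtain ⟨θ, hθ, hθhalf, hscheme⟩ := CKN1982.decay_scheme (κ₁ := (κ₁ : ℝ)) (κ₂ := (κ₂ : ℝ))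
    (κ₃ := (κ₃ : ℝ)) (κ₄ := (κ₄ : ℝ))
    (κ₅ := (2 : ℝ) ^ (1 / 3 : ℝ) * (κ₅ : ℝ) ^ (4 / 3 : ℝ))
    (κ₆ := (2 : ℝ) ^ (1 / 3 : ℝ) * (κ₆ : ℝ) ^ (4 / 3 : ℝ)) (C₀ := (C₀ : ℝ))
    κ₁.coe_nonneg κ₂.coe_nonneg κ₃.coe_nonneg κ₄.coe_nonneg (by positivity) (by positivity)
    C₀.coe_nonneg
  have hθ1 : θ ≤ 1 := hθhalf.trans (by norm_num)
  obtain ⟨ε, hε, η, hη, hsteps⟩ := hscheme (ε₀q ^ 3) (by positivity)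
  refine ⟨ε / 4, by positivity, fun z₀ u p G hIB hG x hx hlim hsing => ?_⟩
  -- ### data
  set Q : Opens (ℝ × EuclideanSpace ℝ (Fin 3)) := parabolicCylinderOpens 1 z₀ with hQ
  have hQset : (Q : Set (ℝ × EuclideanSpace ℝ (Fin 3))) = parabolicCylinder 1 z₀ := rfl
  have hsws : IsSuitableWeakSolutionOn Q 1 0 u p := hIB.1
  obtain ⟨Cu, hCu⟩ := hIB.2.1
  obtain ⟨Gw, hLR⟩ := hIB.exists_isLRSuitableWeakSolutionOn 3
  have hq : (5 : ℝ) / 2 < 3 := by norm_num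
  have hq0 : (0 : ℝ) < 3 := by norm_num
  have hfq : MemLp (uncurry (0 : ℝ → EuclideanSpace ℝ (Fin 3) → EuclideanSpace ℝ (Fin 3))) (ENNReal.ofReal 3)
      (volume.restrict (Q : Set (ℝ × EuclideanSpace ℝ (Fin 3)))) := MemLp.zero'
  have hfli : LocallyIntegrableOn (uncurry (0 : ℝ → EuclideanSpace ℝ (Fin 3) → EuclideanSpace ℝ (Fin 3)))
      (Q : Set (ℝ × EuclideanSpace ℝ (Fin 3))) volume := locallyIntegrableOn_of_memLp (by norm_num) hfq
  have hdiv : ∀ φ : ℝ → EuclideanSpace ℝ (Fin 3) → ℝ, IsSpaceTimeTestOn Q φ →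
      ∫ t, ∫ x, ⟪(0 : ℝ → EuclideanSpace ℝ (Fin 3) → EuclideanSpace ℝ (Fin 3)) t x, gradient (φ t) x⟫ = 0 := by
    intro φ _; simp
  -- finiteness of `∫∫_Q |G|²` (the weak gradients agree a.e.) and of `∫∫_Q |p|^{3/2}`
  have hNG : ∫⁻ w in (Q : Set (ℝ × EuclideanSpace ℝ (Fin 3))), ENNReal.ofReal (frobeniusNormSq (G w.1 w.2)) < ∞ := by
    have hae := hG.ae_eq hLR.weakGradient
    have : ∫⁻ w in (Q : Set (ℝ × EuclideanSpace ℝ (Fin 3))), ENNReal.ofReal (frobeniusNormSq (G w.1 w.2)) =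
        ∫⁻ w in (Q : Set (ℝ × EuclideanSpace ℝ (Fin 3))), ENNReal.ofReal (frobeniusNormSq (Gw w.1 w.2)) := by
      refine lintegral_congr_ae ?_
      filter_upwards [hae] with w hw
      change ENNReal.ofReal (frobeniusNormSq (uncurry G w)) = ENNReal.ofReal (frobeniusNormSq (uncurry Gw w))
      rw [hw]
    rw [this]; exact hLR.gradient_lt_top
  have hNp := hLR.pressure_lt_top
  -- ### geometry: room around `x`
  obtain ⟨δx, hδx⟩ : ∃ δx : ℝ, δx = 1 - dist x z₀.2 := ⟨_, rfl⟩
  have hδx0 : 0 < δx := by rw [hδx]; linarith [mem_ball.1 hx]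
  obtain ⟨r₁, hr₁def⟩ : ∃ r₁ : ℝ, r₁ = min (δx / 2) (1 / 2) := ⟨_, rfl⟩
  have hr₁ : 0 < r₁ := by rw [hr₁def]; positivity
  have hr₁δ : r₁ ≤ δx / 2 := by rw [hr₁def]; exact min_le_left _ _
  have hr₁h : r₁ ≤ 1 / 2 := by rw [hr₁def]; exact min_le_right _ _
  -- cylinders `Q_r(T − η', x)`, `0 ≤ η' ≤ 1/4`, `0 < r ≤ r₁`: closure inside `Q`, and inside `Q` itself
  have hbox : ∀ η' r : ℝ, 0 < η' → η' ≤ 1 / 4 → 0 < r → r ≤ r₁ →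
      closure (parabolicCylinder r ((z₀.1 - η', x) : ℝ × EuclideanSpace ℝ (Fin 3))) ⊆
        (Q : Set (ℝ × EuclideanSpace ℝ (Fin 3))) := by
    intro η' r hη' hη'1 hr hrr
    refine (closure_parabolicCylinder_subset r _).trans ?_
    rw [hQset]
    rintro ⟨t, y⟩ ⟨ht, hy⟩
    rw [mem_parabolicCylinder]
    simp only [mem_Icc, mem_closedBall] at ht hy ⊢
    have hr2 : r ^ 2 ≤ 1 / 4 := by nlinarith
    refine ⟨⟨by nlinarith [ht.1], by linarith [ht.2]⟩, ?_⟩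
    calc dist y z₀.2 ≤ dist y x + dist x z₀.2 := dist_triangle _ _ _
      _ ≤ r + (1 - δx) := add_le_add hy (by rw [hδx]; linarith)
      _ < 1 := by linarith
  have hsubQ : ∀ η' r : ℝ, 0 < η' → η' ≤ 1 / 4 → 0 < r → r ≤ r₁ →
      parabolicCylinder r ((z₀.1 - η', x) : ℝ × EuclideanSpace ℝ (Fin 3)) ⊆ (Q : Set (ℝ × EuclideanSpace ℝ (Fin 3))) :=
    fun η' r hη' hη'1 hr hrr => subset_closure.trans (hbox η' r hη' hη'1 hr hrr)
  -- the scale `r_E` below which the BACKWARD dissipation at `(T, x)` is `< ε/2`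
  obtain ⟨rE, hrE, hElt⟩ := exists_forall_lt_of_limsup_le hlim
    ((ENNReal.ofReal_lt_ofReal_iff (by positivity)).2 (by linarith : ε / 4 < ε / 2))
  -- the starting scale `r₀`
  obtain ⟨r₀, hr₀, hr₀r₁, hr₀E⟩ : ∃ r₀ : ℝ, 0 < r₀ ∧ r₀ ≤ r₁ ∧ 2 * r₀ < rE :=
    ⟨min r₁ (rE / 4), by positivity, min_le_left _ _,
      by linarith [min_le_right r₁ (rE / 4)]⟩
  -- the a-priori bound `M` and the number of steps `k`
  obtain ⟨k, hk⟩ := hsteps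
    (((ENNReal.ofReal r₀)⁻¹ * Cu).toReal +
      ((((ENNReal.ofReal r₀) ^ 2)⁻¹ *
        ∫⁻ w in (Q : Set (ℝ × EuclideanSpace ℝ (Fin 3))), ‖p w.1 w.2‖ₑ ^ (3 / 2 : ℝ)) ^ (4 / 3 : ℝ)).toReal)
  -- the last scale `ρ`
  obtain ⟨ρ, hρdef⟩ : ∃ ρ : ℝ, ρ = θ ^ k * r₀ := ⟨_, rfl⟩
  have hρ : 0 < ρ := by rw [hρdef]; positivity
  have hρr₀ : ρ ≤ r₀ := by
    rw [hρdef]; exact mul_le_of_le_one_left hr₀.le (pow_le_one₀ hθ.le hθ1)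
  -- the scales `s j = θʲ r₀`
  have hs0 : ∀ j : ℕ, 0 < θ ^ j * r₀ := fun j => by positivity
  have hsr₀ : ∀ j : ℕ, θ ^ j * r₀ ≤ r₀ := fun j =>
    mul_le_of_le_one_left hr₀.le (pow_le_one₀ hθ.le hθ1)
  have hsρ : ∀ j ≤ k, ρ ≤ θ ^ j * r₀ := fun j hj => by
    rw [hρdef]
    exact mul_le_mul_of_nonneg_right (pow_le_pow_of_le_one hθ.le hθ1 hj) hr₀.le
  have hsucc : ∀ j : ℕ, θ * (θ ^ j * r₀) = θ ^ (j + 1) * r₀ := fun j => by rw [pow_succ]; ring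
  have hρsq : ρ ^ 2 ≤ 1 / 4 := by nlinarith
  -- ### the scheme at the shifted centre `z' = (T − η', x)`, for every `0 < η' ≤ ρ²`
  have hstep : ∀ η' : ℝ, 0 < η' → η' ≤ ρ ^ 2 →
      ∀ᵐ w ∂(volume.restrict (parabolicCylinder (ρ / 2) ((z₀.1 - η', x) : ℝ × EuclideanSpace ℝ (Fin 3)))),
        ‖u w.1 w.2‖ ≤ C₀q * ε₀q / ρ := by
    intro η' hη' hη'ρ
    have hη'1 : η' ≤ 1 / 4 := hη'ρ.trans hρsq
    set z' : ℝ × EuclideanSpace ℝ (Fin 3) := (z₀.1 - η', x) with hz'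
    have hclQ : ∀ r, 0 < r → r ≤ r₀ → closure (parabolicCylinder r z') ⊆ (Q : Set (ℝ × EuclideanSpace ℝ (Fin 3))) :=
      fun r hr hrr => hbox η' r hη' hη'1 hr (hrr.trans hr₀r₁)
    have hsubK : ∀ r, 0 < r → r ≤ r₀ → parabolicCylinder r z' ⊆ (Q : Set (ℝ × EuclideanSpace ℝ (Fin 3))) :=
      fun r hr hrr => hsubQ η' r hη' hη'1 hr (hrr.trans hr₀r₁)
    -- finiteness of the scaled quantities at admissible radii
    have hAle : ∀ r, 0 < r → r ≤ r₀ → cknAEss r z' u ≤ (ENNReal.ofReal r)⁻¹ * Cu := fun r hr hrr =>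
      AlbrittonBarker2019.cknAEss_le_of_energyClass hCu hr (by rw [← hQset]; exact hsubK r hr hrr)
    have hAfin : ∀ r, 0 < r → r ≤ r₀ → cknAEss r z' u ≠ ∞ := fun r hr hrr =>
      ne_top_of_le_ne_top (ENNReal.mul_ne_top (ENNReal.inv_ne_top.2 (ENNReal.ofReal_pos.2 hr).ne')
        ENNReal.coe_ne_top) (hAle r hr hrr)
    have hEfin : ∀ r, 0 < r → r ≤ r₀ → cknE r z' G ≠ ∞ := fun r hr hrr =>
      ne_top_of_le_ne_top (ENNReal.mul_ne_top (ENNReal.inv_ne_top.2 (ENNReal.ofReal_pos.2 hr).ne')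
        hNG.ne) (cknE_le_of_subset G (hsubK r hr hrr))
    have hDfin : ∀ r, 0 < r → r ≤ r₀ → cknD r z' p ≠ ∞ := fun r hr hrr =>
      ne_top_of_le_ne_top (ENNReal.mul_ne_top
        (ENNReal.inv_ne_top.2 (pow_ne_zero 2 (ENNReal.ofReal_pos.2 hr).ne')) hNp.ne)
        (cknD_le_of_subset p (hsubK r hr hrr))
    have hF0 : ∀ r, cknF 3 r z' (0 : ℝ → EuclideanSpace ℝ (Fin 3) → EuclideanSpace ℝ (Fin 3)) = 0 :=
      fun r => cknF_zero hq0 z'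
    have hGr : ∀ r, 0 < r → r ≤ r₀ → HasWeakSpatialGradientOn (parabolicCylinderOpens r z') u G :=
      fun r hr hrr => hG.mono (hsubK r hr hrr)
    have hCfin : ∀ r, 0 < r → r ≤ r₀ → cknC r z' u ≠ ∞ := fun r hr hrr =>
      ne_top_of_le_ne_top (ENNReal.mul_ne_top ENNReal.coe_ne_top (ENNReal.rpow_ne_top_of_nonneg
        (by norm_num) (ENNReal.add_ne_top.2 ⟨hAfin r hr hrr, hEfin r hr hrr⟩)))
        (hIE u G z' r hr (hGr r hr hrr) (hAfin r hr hrr) (hEfin r hr hrr))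
    -- the dissipation inputs are small: `E(s; z') ≤ 2 E(2s; (T,x)) < ε` for `ρ ≤ s ≤ r₀`
    have hEsmall : ∀ j ≤ k, (cknE (θ ^ j * r₀) z' G).toReal ≤ ε := by
      intro j hj
      have hsj := hs0 j
      have h1 : cknE (θ ^ j * r₀) z' G ≤ 2 * cknE (2 * (θ ^ j * r₀)) (z₀.1, x) G := by
        refine cknE_shift_down_le hη'.le ?_ hsj G
        have := hsρ j hj
        nlinarith
      have h2 : cknE (2 * (θ ^ j * r₀)) ((z₀.1, x) : ℝ × EuclideanSpace ℝ (Fin 3)) G < ENNReal.ofReal (ε / 2) :=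
        hElt _ (by positivity) (by nlinarith [hsr₀ j])
      have h3 : cknE (θ ^ j * r₀) z' G ≤ ENNReal.ofReal ε := by
        refine h1.trans ((mul_le_mul' le_rfl h2.le).trans ?_)
        rw [← ENNReal.ofReal_ofNat, ← ENNReal.ofReal_mul (by norm_num)]
        exact ENNReal.ofReal_le_ofReal (by linarith)
      exact ENNReal.toReal_le_of_le_ofReal hε.le h3
    -- the real sequences and the scheme
    have hmain := hk (fun j => (cknAEss (θ ^ j * r₀) z' u).toReal)
      (fun j => (cknE (θ ^ j * r₀) z' G).toReal)
      (fun j => (cknD (θ ^ j * r₀) z' p ^ (4 / 3 : ℝ)).toReal)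
      (fun j => (cknF 3 (θ ^ j * r₀) z' (0 : ℝ → EuclideanSpace ℝ (Fin 3) → EuclideanSpace ℝ (Fin 3)) ^
        (2 / (3 : ℝ))).toReal)
      ((cknC (θ ^ k * r₀) z' u).toReal)
      (fun j => ENNReal.toReal_nonneg) (fun j => ENNReal.toReal_nonneg)
      (fun j => ENNReal.toReal_nonneg) (fun j => ENNReal.toReal_nonneg) ENNReal.toReal_nonneg
      (fun j hj => by
        -- local-energy estimate at `(s j, θ)`
        have H := hLE Q 3 0 u p G hsws hq hfq hG z' (θ ^ j * r₀) θ (hs0 j) hθ hθhalf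
          (hclQ _ (hs0 j) (hsr₀ j))
        rw [hsucc j] at H
        exact real_localEnergy le_self_add H hq0 (hAfin _ (hs0 j) (hsr₀ j))
          (hEfin _ (hs0 j) (hsr₀ j)) (hDfin _ (hs0 j) (hsr₀ j)) (by rw [hF0]; exact ENNReal.zero_ne_top))
      (fun j hj => by
        -- pressure estimate at `(s j, θ)`
        have H := hPE Q 0 u p G hsws hfli hdiv hG z' (θ ^ j * r₀) θ (hs0 j) hθ hθhalf
          (hclQ _ (hs0 j) (hsr₀ j))
        rw [hsucc j] at H
        exact real_pressure hθ hθ1 H (hAfin _ (hs0 j) (hsr₀ j)) (hEfin _ (hs0 j) (hsr₀ j))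
          (hDfin _ (hs0 j) (hsr₀ j)))
      (by
        -- interpolation at the last scale
        exact real_interpolation (hIE u G z' (θ ^ k * r₀) (hs0 k) (hGr _ (hs0 k) (hsr₀ k))
          (hAfin _ (hs0 k) (hsr₀ k)) (hEfin _ (hs0 k) (hsr₀ k))) (hAfin _ (hs0 k) (hsr₀ k))
          (hEfin _ (hs0 k) (hsr₀ k)))
      hEsmall
      (fun j hj => by
        -- force smallness (the force vanishes)
        refine real_force hq0 hη.le ?_
        rw [hF0]; exact bot_le)
      (by
        -- the a-priori bound at `r₀`
        have e0 : θ ^ 0 * r₀ = r₀ := by simp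
        simp only [e0]
        have hA0 : cknAEss r₀ z' u ≤ (ENNReal.ofReal r₀)⁻¹ * Cu := hAle r₀ hr₀ le_rfl
        have hD0 : cknD r₀ z' p ^ (4 / 3 : ℝ) ≤ (((ENNReal.ofReal r₀) ^ 2)⁻¹ *
            ∫⁻ w in (Q : Set (ℝ × EuclideanSpace ℝ (Fin 3))), ‖p w.1 w.2‖ₑ ^ (3 / 2 : ℝ)) ^ (4 / 3 : ℝ) :=
          ENNReal.rpow_le_rpow (cknD_le_of_subset p (hsubK r₀ hr₀ le_rfl)) (by norm_num)
        have hfinA : (ENNReal.ofReal r₀)⁻¹ * (Cu : ℝ≥0∞) ≠ ∞ :=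
          ENNReal.mul_ne_top (ENNReal.inv_ne_top.2 (ENNReal.ofReal_pos.2 hr₀).ne') ENNReal.coe_ne_top
        have hfinD : (((ENNReal.ofReal r₀) ^ 2)⁻¹ *
            ∫⁻ w in (Q : Set (ℝ × EuclideanSpace ℝ (Fin 3))), ‖p w.1 w.2‖ₑ ^ (3 / 2 : ℝ)) ^ (4 / 3 : ℝ) ≠ ∞ :=
          ENNReal.rpow_ne_top_of_nonneg (by norm_num) (ENNReal.mul_ne_top
            (ENNReal.inv_ne_top.2 (pow_ne_zero 2 (ENNReal.ofReal_pos.2 hr₀).ne')) hNp.ne)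
        exact add_le_add (ENNReal.toReal_mono hfinA hA0) (ENNReal.toReal_mono hfinD hD0))
    -- back to `ℝ≥0∞`: `C(ρ) + D(ρ) ≤ ε₀q³` at the shifted centre
    beta_reduce at hmain
    rw [← hρdef] at hmain
    have hsmall : cknC ρ z' u + cknD ρ z' p ≤ ENNReal.ofReal (ε₀q ^ 3) :=
      add_le_ofReal_of_real (hCfin ρ hρ hρr₀) (hDfin ρ hρ hρr₀) hmain
    -- the quantitative one-scale criterion at `z'` (open inclusion `Q_ρ(z') ⊆ Q`)
    have hum : AEMeasurable (fun w : ℝ × EuclideanSpace ℝ (Fin 3) => ‖u w.1 w.2‖ₑ ^ (3 : ℕ))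
        (volume.restrict (parabolicCylinder ρ z')) := by
      have h1 := (hLR.weakGradient.locallyIntegrableOn.mono_set (hsubK ρ hρ hρr₀)).aestronglyMeasurable
      exact h1.enorm.pow_const _
    have hint := setLIntegral_cubic_add_pressure_le_of_cknC_add_cknD_le (p := p) hρ hum hsmall
    exact hunf Q 3 u p Gw (by norm_num) hLR z' ρ ε₀q hρ (hsubK ρ hρ hρr₀) hε₀q.le le_rfl hint
  -- ### exhaustion of `Q_{ρ/2}(T, x)` by the cylinders `Q_{ρ/2}(T − ρ²/(n+2), x)`
  have hall : ∀ n : ℕ, ∀ᵐ w ∂(volume.restrict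
      (parabolicCylinder (ρ / 2) ((z₀.1 - ρ ^ 2 / ((n : ℝ) + 2), x) : ℝ × EuclideanSpace ℝ (Fin 3)))),
      ‖u w.1 w.2‖ ≤ C₀q * ε₀q / ρ := by
    intro n
    have hn2 : (0 : ℝ) < (n : ℝ) + 2 := by positivity
    refine hstep _ (by positivity) ?_
    rw [div_le_iff₀ hn2]
    nlinarith [n.cast_nonneg (α := ℝ)]
  have hU := (ae_restrict_iUnion_iff (μ := volume)
    (s := fun n : ℕ => parabolicCylinder (ρ / 2) ((z₀.1 - ρ ^ 2 / ((n : ℝ) + 2), x) : ℝ × EuclideanSpace ℝ (Fin 3)))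
    (p := fun w => ‖u w.1 w.2‖ ≤ C₀q * ε₀q / ρ)).2 hall
  have hbound : ∀ᵐ w ∂(volume.restrict (parabolicCylinder (ρ / 2) ((z₀.1, x) : ℝ × EuclideanSpace ℝ (Fin 3)))),
      ‖u w.1 w.2‖ ≤ C₀q * ε₀q / ρ :=
    ae_restrict_of_ae_restrict_of_subset (parabolicCylinder_subset_iUnion_shift hρ) hU
  have hfin : eLpNorm (uncurry u) ∞ (volume.restrict (parabolicCylinder (ρ / 2)
      ((z₀.1, x) : ℝ × EuclideanSpace ℝ (Fin 3)))) < ∞ := by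
    rw [eLpNorm_exponent_top]
    exact eLpNormEssSup_lt_top_of_ae_bound (C := C₀q * ε₀q / ρ) (by
      filter_upwards [hbound] with w hw
      exact hw)
  exact absurd (hsing (ρ / 2) (by positivity)) hfin.ne

end Summit.NavierStokesRegularity.NavierStokesRegularity.Theorems.AveragedConeLiouville.LidEpsilon

end
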